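import Mathlib.MeasureTheory.Integral.IntervalIntegral.FundThmCalculus
import Literature.Analysis.FunctionSpaces.TorusCalculusProofs
import Literature.Analysis.FunctionSpaces.TorusFluidGlue
import HarnessLib

/-!
# Discharged facts: energy balance and "classical ⇒ weak" for Navier–Stokes on `T^d`

`Literature.Analysis.FunctionSpaces.TorusFluidGlue` records two sanity properties of classical
solutions of the forced incompressible Navier–Stokes system on `T^d × S` as named facts
(`def … : Prop`). This file proves both.

## The energy balance (`Torus.IsClassicalNSSolutionOn.energy_balance_holds`)

For `S` convex and `t ∈ S`,
`d/dt E(u(t)) = -ν ‖∇u(t)‖₂² + ∫ ⟪f(t), u(t)⟫` as a one-sided derivative within `S`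
(Doering–Foias 2002, §2, eq. (2.4); Constantin–Foias 1988, Ch. 9, the energy equation
`½ d/dt |u|² + ν ‖u‖² = (f, u)` (p. 48) behind (13.5)), following the
printed argument: take the `L²(T^d)` inner product of the momentum equation with `u`; the time
derivative commutes with the space integral (`Torus.IsSmoothSpaceTimeOn.hasDerivWithinAt_integral`,
joint smoothness on the compact torus and convexity of `S`); the convective term
`∫ ⟪(u·∇)u, u⟫ = ½ ∫ D‖u‖²[u]` and the pressure term `∫ ⟪∇p, u⟫ = ∫ Dp[u]` vanish for
divergence-free `u` (`Torus.integral_fderiv_apply_eq_zero_of_isDivFree`); and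
`∫ ⟪u, Δu⟫ = -‖∇u‖₂²` (`Torus.integral_inner_laplacian_eq_neg_holds`).

The statement was found faithful as vendored (not mis-stated): at an isolated point of `S` the
one-sided derivative claim is vacuous, and otherwise the convex `S` is an interval with nonempty
interior, on which `derivWithin` is the genuine one-sided time derivative.

## Classical solutions are weak solutions (`Torus.IsClassicalNSSolutionOn.isWeakNSSolutionOn_holds`)

A classical solution on a time set `S ⊇ [0, T]`, unforced on `[0, T]`, is a weak solution on
`T^d × (0, T)` in the sense of De Lellis–Székelyhidi 2009, §1, eq. (2) (the distributional
identity `∫∫ (v ∂ₜφ + ⟨v ⊗ v, ∇φ⟩) = 0` against divergence-free `φ ∈ C_c^∞`, here with the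
viscous term `ν ⟪v, Δφ⟫` of Buckmaster–Vicol 2019, Def. 1.1, and `⟨v ⊗ v, ∇φ⟩ = ⟪v, (v·∇)φ⟫`).
The proof is the standard remark behind the definition: `u` is continuous on the compact
`[0, T] × T^d`, hence measurable and square integrable on `(0, T) × T^d`; `div u(t) = 0`
classically implies weakly (`Torus.IsDivFree.isWeaklyDivFree_holds`); and for a divergence-free
test field `ψ` supported in `(0, T)` the pairing `E(t) = ∫ ⟪u(t), ψ(t)⟫` vanishes at `t = 0`
and `t = T`, is differentiable within `[0, T]` with
`E'(t) = ∫ (⟪u, ∂ₜψ⟫ + ⟪νΔu - ∇p - (u·∇)u, ψ⟫)` (differentiation under the integral and the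
momentum equation), and the three integrations by parts on the torus
`∫ ⟪Δu, ψ⟫ = ∫ ⟪u, Δψ⟫` (`Torus.integral_inner_laplacian_comm`, Evans App. C.2 Thm. 3),
`∫ ⟪∇p, ψ⟫ = 0` (`Torus.integral_inner_gradient_eq_zero_of_isDivFree`) and
`∫ ⟪(u·∇)u, ψ⟫ = -∫ ⟪u, (u·∇)ψ⟫` (`Torus.integral_inner_convect_eq_neg`, Temam Ch. II
Lemma 1.3) turn `E'` into the weak integrand; `∫₀ᵀ E' = E(T) - E(0) = 0` is the weak identity.
The statement was found faithful as vendored (not mis-stated).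

## References

* C. R. Doering, C. Foias, *Energy dissipation in body-forced turbulence*, J. Fluid Mech. 467
  (2002), 289–306, §2, eq. (2.4).
* P. Constantin, C. Foias, *Navier–Stokes Equations*, Chicago Lectures in Math. (1988), Ch. 9
  (energy equation, p. 48) and Ch. 13, (13.5).
* C. De Lellis, L. Székelyhidi Jr., *The Euler equations as a differential inclusion*, Ann. of
  Math. (2) 170 (2009), 1417–1436 (arXiv:math/0702079), §1, eq. (2) (weak solutions).
* T. Buckmaster, V. Vicol, *Nonuniqueness of weak solutions to the Navier–Stokes equation*,
  Ann. of Math. (2) 189 (2019), 101–144, Def. 1.1.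
* R. Temam, *Navier–Stokes Equations. Theory and Numerical Analysis*, 3rd ed. (1984), Ch. II
  §1.2, Lemma 1.3 (the trilinear form `b(u,v,w) = -b(u,w,v)`).
* L. C. Evans, *Partial Differential Equations*, 2nd ed. (2010), App. C.2 (integration by parts).
-/


open MeasureTheory Set Topology Filter
open scoped InnerProductSpace ContDiff ENNReal

noncomputable section

namespace Literature.Analysis.FunctionSpaces

namespace Torus

variable {d : Type*} [Fintype d] [DecidableEq d]

/-- Discharge of the named fact `Torus.IsClassicalNSSolutionOn.energy_balance`: for a classical
solution of the forced Navier–Stokes system on `T^d × S`, `S` a convex time set, the kinetic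
energy `E(u(s)) = ½ ∫ ‖u(s)‖²` has one-sided derivative `-ν ‖∇u(t)‖₂² + ∫ ⟪f(t), u(t)⟫` within
`S` at every `t ∈ S` (Doering–Foias 2002, §2, eq. (2.4): differentiate under the integral,
`d/dt ½‖u‖² = ⟪u, ∂ₜu⟫`, insert the momentum equation; the convective and pressure terms
integrate to zero by incompressibility and `∫ ⟪u, νΔu⟫ = -ν ‖∇u‖₂²`). At an isolated point of
`S` the statement is vacuous (`HasFDerivWithinAt.of_not_accPt`); otherwise `S` is an interval
with nonempty interior, hence a set of unique differentiability. [cite: DoeringFoias2002, §2  eq. (2.4)] -/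
theorem IsClassicalNSSolutionOn.energy_balance_holds :
    IsClassicalNSSolutionOn.energy_balance (d := d) := by
  intro S ν f u p h hS t ht
  by_cases hacc : AccPt t (𝓟 S)
  swap
  · exact HasFDerivWithinAt.of_not_accPt hacc
  have hU : UniqueDiffOn ℝ S :=
    uniqueDiffOn_convex hS (interior_nonempty_of_convex_of_accPt hS ht hacc)
  have hu : IsSmoothSpaceTimeOn S u := h.smooth_velocity
  have hut : IsSmooth (u t) := hu.isSmooth_slice ht
  have hpt : IsSmooth (p t) := h.smooth_pressure.isSmooth_slice ht
  have hA : IsSmooth (timeDerivWithin S u t) := hu.isSmooth_timeDerivWithin hU ht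
  -- Step 1: differentiate the kinetic energy under the integral sign, `dE/dt = ∫ ⟪∂ₜu, u⟫`.
  have hφ : IsSmoothSpaceTimeOn S (fun s x => ‖u s x‖ ^ 2) := by
    change ContDiffOn ℝ ∞ (fun z => ‖stLift u z‖ ^ 2) (S ×ˢ univ)
    exact hu.norm_sq ℝ
  have hE : HasDerivWithinAt (fun s => kineticEnergy (u s))
      (2⁻¹ * ∫ x, timeDerivWithin S (fun s x => ‖u s x‖ ^ 2) t x) S t :=
    (hφ.hasDerivWithinAt_integral hS ht).const_mul 2⁻¹
  have htd : ∀ x, timeDerivWithin S (fun s x => ‖u s x‖ ^ 2) t x =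
      2 * ⟪timeDerivWithin S u t x, u t x⟫_ℝ := by
    intro x
    have h2 := ((hu.hasDerivWithinAt_slice ht x).norm_sq).derivWithin (hU t ht)
    rw [real_inner_comm] at h2
    exact h2
  have hE' : 2⁻¹ * ∫ x, timeDerivWithin S (fun s x => ‖u s x‖ ^ 2) t x =
      ∫ x, ⟪timeDerivWithin S u t x, u t x⟫_ℝ := by
    simp_rw [htd, integral_const_mul]
    ring
  rw [hE'] at hE
  convert hE using 1
  -- Step 2: insert the momentum equation and integrate by parts on the torus.
  have hf_eq : ∀ x, f t x = timeDerivWithin S u t x + convect (u t) (u t) x -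
      ν • laplacian (u t) x + gradient (p t) x := by
    intro x
    rw [h.momentum t ht x]
    abel
  have iA : Integrable (fun x => ⟪timeDerivWithin S u t x, u t x⟫_ℝ) volume :=
    (hA.inner hut).integrable
  have iC : Integrable (fun x => ⟪convect (u t) (u t) x, u t x⟫_ℝ) volume :=
    ((hut.convect hut).inner hut).integrable
  have iL : Integrable (fun x => ⟪ν • laplacian (u t) x, u t x⟫_ℝ) volume :=
    ((hut.laplacian.smul ν).inner hut).integrable
  have iG : Integrable (fun x => ⟪gradient (p t) x, u t x⟫_ℝ) volume :=
    (hpt.gradient.inner hut).integrable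
  have hsplit : ∫ x, ⟪f t x, u t x⟫_ℝ = (∫ x, ⟪timeDerivWithin S u t x, u t x⟫_ℝ) +
      (∫ x, ⟪convect (u t) (u t) x, u t x⟫_ℝ) - (∫ x, ⟪ν • laplacian (u t) x, u t x⟫_ℝ) +
      ∫ x, ⟪gradient (p t) x, u t x⟫_ℝ := by
    simp_rw [hf_eq, inner_add_left, inner_sub_left, inner_add_left]
    rw [integral_add ?_ iG, integral_sub ?_ iL, integral_add iA iC]
    · exact iA.add iC
    · exact (iA.add iC).sub iL
  have hlap : ∫ x, ⟪ν • laplacian (u t) x, u t x⟫_ℝ = -ν * gradNormSq (u t) := by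
    have hcomm : (fun x => ⟪ν • laplacian (u t) x, u t x⟫_ℝ) =
        fun x => ν * ⟪u t x, laplacian (u t) x⟫_ℝ :=
      funext fun x => by rw [real_inner_smul_left, real_inner_comm]
    rw [hcomm, integral_const_mul, integral_inner_laplacian_eq_neg_holds hut, gradNormSq,
      integral_finsetSum _ fun i _ => (hut.partialDeriv i).norm_sq.integrable]
    ring
  rw [hsplit, hlap, integral_inner_convect_self_eq_zero hut (h.divFree t ht),
    integral_inner_gradient_eq_zero_of_isDivFree hut hpt (h.divFree t ht)]
  ring

/-! ## More integration by parts on the torus: Green symmetry and the trilinear form -/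

section MoreIBP

variable {G : Type*} [NormedAddCommGroup G] [InnerProductSpace ℝ G]

/-- `∫ ⟪∂ᵢ u, w⟫ = -∫ ⟪u, ∂ᵢ w⟫` for smooth fields with values in a real inner product space
(product rule `Torus.partialDeriv_inner` and `∫ ∂ᵢ ⟪u, w⟫ = 0`; Evans, App. C.2, Thm. 2, empty
boundary). [cite: Evans2010, App. C.2 Thm. 2] -/
theorem integral_inner_partialDeriv_eq_neg {u w : UnitAddTorus d → G} (hu : IsSmooth u)
    (hw : IsSmooth w) (i : d) :
    ∫ x, ⟪partialDeriv i u x, w x⟫_ℝ = -∫ x, ⟪u x, partialDeriv i w x⟫_ℝ := by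
  have h0 := integral_partialDeriv_eq_zero_holds (F := ℝ) (hu.inner hw) i
  have hprod : partialDeriv i (fun y => ⟪u y, w y⟫_ℝ) =
      fun x => ⟪u x, partialDeriv i w x⟫_ℝ + ⟪partialDeriv i u x, w x⟫_ℝ :=
    funext (partialDeriv_inner (hu.isContDiff (by simp)) (hw.isContDiff (by simp)) i)
  rw [hprod, integral_add (hu.inner (hw.partialDeriv i)).integrable
    ((hu.partialDeriv i).inner hw).integrable] at h0
  linarith

/-- Green's second identity for fields with values in a real inner product space:
`∫ ⟪Δu, w⟫ = ∫ ⟪u, Δw⟫` for smooth `u`, `w` on `T^d` (both sides equal `-∑ᵢ ∫ ⟪∂ᵢ u, ∂ᵢ w⟫`;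
Evans, App. C.2, Thm. 3 (iii), empty boundary). [cite: Evans2010, App. C.2 Thm. 3 (iii)] -/
theorem integral_inner_laplacian_comm {u w : UnitAddTorus d → G} (hu : IsSmooth u)
    (hw : IsSmooth w) : ∫ x, ⟪laplacian u x, w x⟫_ℝ = ∫ x, ⟪u x, laplacian w x⟫_ℝ := by
  -- both sides equal `-∑ᵢ ∫ ⟪∂ᵢ u, ∂ᵢ w⟫`
  have key : ∀ {a b : UnitAddTorus d → G}, IsSmooth a → IsSmooth b →
      ∫ x, ⟪laplacian a x, b x⟫_ℝ = -∑ i, ∫ x, ⟪partialDeriv i a x, partialDeriv i b x⟫_ℝ := by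
    intro a b ha hb
    simp_rw [laplacian_eq_sum_partialDeriv_partialDeriv ha, sum_inner]
    rw [integral_finsetSum _ fun i _ =>
        (((ha.partialDeriv i).partialDeriv i).inner hb).integrable,
      ← Finset.sum_neg_distrib]
    exact Finset.sum_congr rfl fun i _ =>
      integral_inner_partialDeriv_eq_neg (ha.partialDeriv i) hb i
  calc ∫ x, ⟪laplacian u x, w x⟫_ℝ
      = -∑ i, ∫ x, ⟪partialDeriv i u x, partialDeriv i w x⟫_ℝ := key hu hw
    _ = -∑ i, ∫ x, ⟪partialDeriv i w x, partialDeriv i u x⟫_ℝ := by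
        congr 1
        exact Finset.sum_congr rfl fun i _ =>
          integral_congr_ae (ae_of_all _ fun x => real_inner_comm _ _)
    _ = ∫ x, ⟪laplacian w x, u x⟫_ℝ := (key hw hu).symm
    _ = ∫ x, ⟪u x, laplacian w x⟫_ℝ := integral_congr_ae (ae_of_all _ fun x => real_inner_comm _ _)

/-- The trilinear form on divergence-free fields: for smooth `u : T^d → ℝ^d` with `div u = 0`
and smooth `v`, `w`, `∫ ⟪(u·∇)v, w⟫ + ∫ ⟪v, (u·∇)w⟫ = 0` (the integrand is `D⟪v, w⟫[u]`, whose
integral vanishes by the transport identity `Torus.integral_fderiv_apply_eq_zero_of_isDivFree`;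
Temam, Ch. II §1.2, Lemma 1.3, eq. (1.20)–(1.21)). [cite: Temam1984, Ch. II §1.2 Lemma 1.3] -/
theorem integral_inner_convect_add_eq_zero {u : UnitAddTorus d → EuclideanSpace ℝ d}
    {v w : UnitAddTorus d → G} (hu : IsSmooth u) (hdiv : IsDivFree u) (hv : IsSmooth v)
    (hw : IsSmooth w) :
    (∫ x, ⟪convect u v x, w x⟫_ℝ) + ∫ x, ⟪v x, convect u w x⟫_ℝ = 0 := by
  have h := integral_fderiv_apply_eq_zero_of_isDivFree hu (hv.inner hw) hdiv
  have hpt : (fun x => Torus.fderiv (fun y => ⟪v y, w y⟫_ℝ) x (u x)) =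
      fun x => ⟪convect u v x, w x⟫_ℝ + ⟪v x, convect u w x⟫_ℝ := by
    funext x
    rw [fderiv_inner_apply (hv.isContDiff (by simp)) (hw.isContDiff (by simp)), add_comm]
    rfl
  rw [hpt, integral_add (((hu.convect hv).inner hw).integrable)
    ((hv.inner (hu.convect hw)).integrable)] at h
  exact h

/-- Antisymmetry of the trilinear form: `∫ ⟪(u·∇)v, w⟫ = -∫ ⟪v, (u·∇)w⟫` for smooth
divergence-free `u` and smooth `v`, `w` (Temam, Ch. II §1.2, Lemma 1.3, `b(u,v,w) = -b(u,w,v)`). [cite: Temam1984, Ch. II §1.2 Lemma 1.3] -/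
theorem integral_inner_convect_eq_neg {u : UnitAddTorus d → EuclideanSpace ℝ d}
    {v w : UnitAddTorus d → G} (hu : IsSmooth u) (hdiv : IsDivFree u) (hv : IsSmooth v)
    (hw : IsSmooth w) :
    ∫ x, ⟪convect u v x, w x⟫_ℝ = -∫ x, ⟪v x, convect u w x⟫_ℝ :=
  eq_neg_of_add_eq_zero_left (integral_inner_convect_add_eq_zero hu hdiv hv hw)

/-- Smooth divergence-free fields are weakly divergence free (Temam, Ch. I §1.4):
`Torus.IsDivFree.isWeaklyDivFree` with its integration-by-parts hypothesis discharged by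
`Torus.integral_inner_gradient_eq_neg_integral_mul_divergence_holds`. [folklore] -/
theorem IsDivFree.isWeaklyDivFree_holds {u : UnitAddTorus d → EuclideanSpace ℝ d}
    (hu : IsSmooth u) (h : IsDivFree u) : IsWeaklyDivFree u :=
  h.isWeaklyDivFree integral_inner_gradient_eq_neg_integral_mul_divergence_holds hu

end MoreIBP

/-! ## Classical solutions are weak solutions -/

section ClassicalWeak

omit [DecidableEq d] in
/-- The space integral of the one-sided time derivative of a jointly smooth field is continuous
in time within the time set (uniform continuity of `∂ₜφ` on the compact torus,
`Torus.IsSmoothSpaceTimeOn.eventually_norm_timeDerivWithin_sub_lt`). [folklore] -/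
theorem IsSmoothSpaceTimeOn.continuousOn_integral_timeDerivWithin {F : Type*}
    [NormedAddCommGroup F] [NormedSpace ℝ F] {S : Set ℝ} {φ : ℝ → UnitAddTorus d → F}
    (hφ : IsSmoothSpaceTimeOn S φ) (hS : UniqueDiffOn ℝ S) :
    ContinuousOn (fun s => ∫ x, timeDerivWithin S φ s x) S := by
  intro t ht
  refine Metric.tendsto_nhds.2 fun ε hε => ?_
  filter_upwards [hφ.eventually_norm_timeDerivWithin_sub_lt hS ht (half_pos hε),
    self_mem_nhdsWithin] with s hs hsS
  rw [dist_eq_norm, ← integral_sub (hφ.isSmooth_timeDerivWithin hS hsS).integrable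
    (hφ.isSmooth_timeDerivWithin hS ht).integrable]
  calc ‖∫ x, (timeDerivWithin S φ s x - timeDerivWithin S φ t x)‖
      ≤ ε / 2 * (volume : Measure (UnitAddTorus d)).real univ :=
        norm_integral_le_of_norm_le_const (ae_of_all _ fun x => (hs x).le)
    _ = ε / 2 := by simp
    _ < ε := half_lt_self hε

/-- Discharge of the named fact `Torus.IsClassicalNSSolutionOn.isWeakNSSolutionOn`: a classical
solution of the Navier–Stokes system on a time set `S ⊇ [0, T]`, unforced on `[0, T]`, is a weak
(distributional) solution on `T^d × (0, T)` in the sense of De Lellis–Székelyhidi (2009), §1,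
eq. (2) (with the viscous term; Buckmaster–Vicol 2019, Def. 1.1). Proof, as in the printed
remark that classical solutions are weak: `u` is continuous on the compact `[0,T] × T^d`, hence
measurable and square integrable; `div u(t) = 0` classically implies weakly
(`Torus.IsDivFree.isWeaklyDivFree_holds`); and for a divergence-free test field `ψ` supported
in `(0, T)`, `E(t) = ∫ ⟪u(t), ψ(t)⟫` satisfies `E(0) = E(T) = 0` and, differentiating under the
integral (`Torus.IsSmoothSpaceTimeOn.hasDerivWithinAt_integral`) and inserting the momentum
equation, `E'(t) = ∫ (⟪u, ∂ₜψ⟫ + ν⟪Δu, ψ⟫ - ⟪∇p, ψ⟫ - ⟪(u·∇)u, ψ⟫)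
= ∫ (⟪u, ∂ₜψ⟫ + ⟪u, (u·∇)ψ⟫ + ν⟪u, Δψ⟫)` by Green's identity, `∫ ⟪∇p, ψ⟫ = 0` and the
antisymmetry of the trilinear form; integrating `E'` over `[0, T]` gives the weak identity. [cite: LellisSzekelyhidi2009, §1 eq. (2)] -/
theorem IsClassicalNSSolutionOn.isWeakNSSolutionOn_holds :
    IsClassicalNSSolutionOn.isWeakNSSolutionOn (d := d) := by
  intro S ν T f u p h hf hS
  have hu : IsSmoothSpaceTimeOn S u := h.smooth_velocity
  have hIoo_S : Ioo 0 T ⊆ S := Ioo_subset_Icc_self.trans hS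
  refine ⟨?_, ?_, ?_, ?_⟩
  -- (1) measurability on `(0,T) × ℝ^d`: `stLift u` is continuous there
  · exact (hu.continuousOn.mono (prod_mono hIoo_S subset_rfl)).aestronglyMeasurable
      (measurableSet_Ioo.prod MeasurableSet.univ)
  -- (2) square integrability: `u` is bounded on `[0,T] × T^d` (compactness)
  · obtain ⟨C, hC⟩ := (isCompact_Icc.prod (isCompact_toLp_image_pi_Icc (d := d)))
      |>.exists_bound_of_continuousOn (f := stLift u)
        (hu.continuousOn.mono (prod_mono hS (subset_univ _)))
    have hb : ∀ t ∈ Ioo 0 T, ∀ x, ‖u t x‖ₑ ^ 2 ≤ ENNReal.ofReal C ^ 2 := by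
      intro t ht x
      have h1 := hC (t, repr x) ⟨Ioo_subset_Icc_self ht, repr_mem_toLp_image_pi_Icc x⟩
      rw [stLift_apply, proj_repr] at h1
      gcongr
      rw [← ofReal_norm]
      exact ENNReal.ofReal_le_ofReal h1
    calc ∫⁻ t in Ioo 0 T, ∫⁻ x, ‖u t x‖ₑ ^ 2
        ≤ ∫⁻ _ in Ioo 0 T, ENNReal.ofReal C ^ 2 :=
          setLIntegral_mono' measurableSet_Ioo fun t ht =>
            calc ∫⁻ x, ‖u t x‖ₑ ^ 2 ≤ ∫⁻ _, ENNReal.ofReal C ^ 2 := lintegral_mono (hb t ht)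
              _ = ENNReal.ofReal C ^ 2 := by rw [lintegral_const, measure_univ, mul_one]
      _ = ENNReal.ofReal C ^ 2 * volume (Ioo 0 T) := setLIntegral_const _ _
      _ < ⊤ := ENNReal.mul_lt_top (ENNReal.pow_lt_top ENNReal.ofReal_lt_top)
          (by rw [Real.volume_Ioo]; exact ENNReal.ofReal_lt_top)
  -- (3) `u(t)` is weakly divergence free for every `t ∈ (0,T)`
  · refine (ae_restrict_iff' measurableSet_Ioo).2 (ae_of_all _ fun t ht => ?_)
    exact (h.divFree t (hIoo_S ht)).isWeaklyDivFree_holds (hu.isSmooth_slice (hIoo_S ht))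
  -- (4) the weak identity
  · intro ψ hψ hψdiv
    rcases le_or_gt T 0 with hT | hT
    · rw [Ioo_eq_empty (not_lt.2 hT), Measure.restrict_empty, integral_zero_measure]
    obtain ⟨⟨hψs, T', hT'T, hT'⟩, ε, hε, hε0⟩ := id hψ
    -- the time interval `I = [0, T] ⊆ S` and the pairing `E(t) = ∫ ⟪u(t), ψ(t)⟫`
    set I : Set ℝ := Icc 0 T with hI_def
    have hIS : I ⊆ S := hS
    have hU : UniqueDiffOn ℝ I := uniqueDiffOn_Icc hT
    have huI : IsSmoothSpaceTimeOn I u := hu.mono (prod_mono hIS subset_rfl)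
    have hψI : IsSmoothSpaceTimeOn I ψ := hψs.contDiffOn
    have hg : IsSmoothSpaceTimeOn I (fun t x => ⟪u t x, ψ t x⟫_ℝ) := by
      change ContDiffOn ℝ ∞ (fun z => ⟪stLift u z, stLift ψ z⟫_ℝ) (I ×ˢ univ)
      exact huI.inner ℝ hψI
    set E : ℝ → ℝ := fun t => ∫ x, ⟪u t x, ψ t x⟫_ℝ with hE_def
    set E' : ℝ → ℝ := fun t => ∫ x, timeDerivWithin I (fun t x => ⟪u t x, ψ t x⟫_ℝ) t x
      with hE'_def
    have hE : ∀ t ∈ I, HasDerivWithinAt E (E' t) I t := fun t ht =>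
      hg.hasDerivWithinAt_integral (convex_Icc 0 T) ht
    have hE'cont : ContinuousOn E' I := hg.continuousOn_integral_timeDerivWithin hU
    -- `∫₀ᵀ E' = E(T) - E(0) = 0`
    have hE0 : E 0 = 0 := by
      simp only [hE_def, hε0 0 hε.le, Pi.zero_apply, inner_zero_right, integral_zero]
    have hET : E T = 0 := by
      simp only [hE_def, hT' T hT'T.le, Pi.zero_apply, inner_zero_right, integral_zero]
    have hFTC : ∫ t in Ioo 0 T, E' t = 0 := by
      rw [← integral_Ioc_eq_integral_Ioo, ← intervalIntegral.integral_of_le hT.le,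
        intervalIntegral.integral_eq_sub_of_hasDerivAt_of_le hT.le
          (fun t ht => (hE t ht).continuousWithinAt)
          (fun t ht => (hE t (Ioo_subset_Icc_self ht)).hasDerivAt (Icc_mem_nhds ht.1 ht.2))
          ((hE'cont.mono (uIcc_of_le hT.le).subset).intervalIntegrable),
        hET, hE0, sub_zero]
    -- the integrand equals `E'` on `(0, T)`
    refine Eq.trans (setIntegral_congr_fun measurableSet_Ioo fun t ht => ?_) hFTC
    have htS : t ∈ S := hIoo_S ht
    have htI : t ∈ I := Ioo_subset_Icc_self ht
    have hut : IsSmooth (u t) := hu.isSmooth_slice htS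
    have hpt : IsSmooth (p t) := h.smooth_pressure.isSmooth_slice htS
    have hψt : IsSmooth (ψ t) := hψI.isSmooth_slice htI
    have hψ't : IsSmooth (timeDeriv ψ t) := hψ.1.timeDeriv.isSmooth_slice t
    -- pointwise: `∂ₜ⟪u, ψ⟫ = ⟪u, ∂ₜψ⟫ + ⟪νΔu - ∇p - (u·∇)u, ψ⟫` on `(0,T)`
    have hI_nhds : I ∈ 𝓝 t := Icc_mem_nhds ht.1 ht.2
    have hS_nhds : S ∈ 𝓝 t := mem_of_superset hI_nhds hIS
    have hslice : ∀ x, timeDerivWithin I (fun t x => ⟪u t x, ψ t x⟫_ℝ) t x =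
        ⟪u t x, timeDeriv ψ t x⟫_ℝ +
          ⟪ν • laplacian (u t) x - gradient (p t) x - convect (u t) (u t) x, ψ t x⟫_ℝ := by
      intro x
      have h1 : HasDerivWithinAt (fun τ => u τ x) (timeDerivWithin S u t x) I t := by
        have h' := huI.hasDerivWithinAt_slice htI x
        rwa [timeDerivWithin, derivWithin_of_mem_nhds hI_nhds, ← derivWithin_of_mem_nhds hS_nhds]
          at h'
      have h2 : HasDerivWithinAt (fun τ => ψ τ x) (timeDeriv ψ t x) I t := by
        obtain ⟨y, rfl⟩ := proj_surjective x
        have hd : Differentiable ℝ (fun τ : ℝ => stLift ψ (τ, y)) :=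
          (hψs.differentiable (by simp)).comp (differentiable_id.prodMk (differentiable_const y))
        exact (hd t).hasDerivAt.hasDerivWithinAt
      have h12 := (h1.inner ℝ h2).derivWithin (hU t htI)
      have hm := h.momentum t htS x
      rw [hf t htI] at hm
      simp only [Pi.zero_apply, add_zero] at hm
      have h3 : timeDerivWithin S u t x =
          ν • laplacian (u t) x - gradient (p t) x - convect (u t) (u t) x := by
        rw [eq_sub_iff_add_eq, hm]
      rw [timeDerivWithin, h12, h3]
    -- integrate over the torus and integrate by parts
    have i1 : Integrable (fun x => ⟪u t x, timeDeriv ψ t x⟫_ℝ) volume := (hut.inner hψ't).integrable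
    have i2 : Integrable (fun x => ⟪u t x, convect (u t) (ψ t) x⟫_ℝ) volume :=
      (hut.inner (hut.convect hψt)).integrable
    have i12 : Integrable (fun x => ⟪u t x, timeDeriv ψ t x⟫_ℝ +
        ⟪u t x, convect (u t) (ψ t) x⟫_ℝ) volume := i1.add i2
    have i3 : Integrable (fun x => ν * ⟪u t x, laplacian (ψ t) x⟫_ℝ) volume :=
      ((hut.inner hψt.laplacian).integrable).const_mul ν
    have iL : Integrable (fun x => ⟪ν • laplacian (u t) x, ψ t x⟫_ℝ) volume :=
      ((hut.laplacian.smul ν).inner hψt).integrable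
    have iG : Integrable (fun x => ⟪gradient (p t) x, ψ t x⟫_ℝ) volume :=
      (hpt.gradient.inner hψt).integrable
    have iC : Integrable (fun x => ⟪convect (u t) (u t) x, ψ t x⟫_ℝ) volume :=
      ((hut.convect hut).inner hψt).integrable
    have iLG : Integrable (fun x => ⟪ν • laplacian (u t) x, ψ t x⟫_ℝ -
        ⟪gradient (p t) x, ψ t x⟫_ℝ) volume := iL.sub iG
    have iLGC : Integrable (fun x => ⟪ν • laplacian (u t) x, ψ t x⟫_ℝ -
        ⟪gradient (p t) x, ψ t x⟫_ℝ - ⟪convect (u t) (u t) x, ψ t x⟫_ℝ) volume := iLG.sub iC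
    have hlap : ∫ x, ⟪ν • laplacian (u t) x, ψ t x⟫_ℝ = ∫ x, ν * ⟪u t x, laplacian (ψ t) x⟫_ℝ := by
      simp_rw [real_inner_smul_left, integral_const_mul]
      rw [integral_inner_laplacian_comm hut hψt]
    have hgrad : ∫ x, ⟪gradient (p t) x, ψ t x⟫_ℝ = 0 :=
      integral_inner_gradient_eq_zero_of_isDivFree hψt hpt (hψdiv t)
    have hconv : ∫ x, ⟪convect (u t) (u t) x, ψ t x⟫_ℝ = -∫ x, ⟪u t x, convect (u t) (ψ t) x⟫_ℝ :=
      integral_inner_convect_eq_neg hut (h.divFree t htS) hut hψt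
    rw [integral_add i12 i3, integral_add i1 i2]
    simp only [hE'_def]
    simp_rw [hslice, inner_sub_left]
    rw [integral_add i1 iLGC, integral_sub iLG iC, integral_sub iL iG, hlap, hgrad, hconv]
    ring

end ClassicalWeak

end Torus

end Literature.Analysis.FunctionSpaces
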